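import Literature.NumberTheory.ComplexMultiplication.EllipticUnits.ImaginaryQuadraticMainConjectureCarriersOLevels
import Literature.NumberTheory.GaloisRepresentations.CohomologicalDimension
import HarnessLib

/-!
# Route `SignedLowerHalves`, crux L `SmallImageLowerHalfBothSigns` (stmt-BirchSwinnertonDyer-23599), line `rtt_w3` v14 — E2, row «D-tw-coh» part 1 (LEAD g11 RULING «U», U5):
# THE LEVEL TWIST `H^i(G_P(F), 𝒪 ⊗ μ_{p^k} ⊗ θ) ≃+ H^i(G_P(F), 𝒪 ⊗ μ_{p^k} ⊗ θ')` when `θ' ≡ θ (mod p^k)` on `Gal(K̄/F)` and on `N_P` — identity on cochains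

INPUTS hand `bsd-inputs-honda-p1` g23 (bus 2026-08-30T18:27:40Z RULING «U» (U3)/(U5): the frame's two-variable skeleton for the infinite-order character `θ* = θ_ψ⁻¹` is
the TRANSPORT of honda g22's datum for the finite-order part `χ₀ = θ*·η⁻¹` along `Tw_η`; «D-tw-coh» = the levelwise coefficient identifications
`𝒪/p^k(1)(χ₀) = 𝒪/p^k(1)(θ*)` on the layers where `η ≡ 1 (mod p^k)`, assembled cofinally). THIS FILE = the LEVELWISE identification, for two arbitrary continuous
characters `θ θ' : Γ_K → 𝒪ˣ` (`𝒪 = padicCoeffIntegers S`), a set of places `P` and an open level subgroup `U`: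
* §1 `muTwistO_eq_of_congr` — if `θ' σ = θ σ + p^k·b` then `σ` acts IDENTICALLY on `𝒪 ⊗ μ_{p^k} ⊗ θ` and `𝒪 ⊗ μ_{p^k} ⊗ θ'` (`p^k` kills `𝒪 ⊗ μ_{p^k}`);
* §2 `twistCoeffMapO` (the identity of `(𝒪 ⊗ μ_{p^k})^{N_P}` read between the two twists, given the congruence on `N_P`), `coe_levelRepO_apply_mk`, `twistLevelHomO`
  (a morphism of topological `U_P`-modules, given the congruence on `U`), ★ `levelTwistO : levelCohO S P θ U k i →+ levelCohO S P θ' U k i` (Mathlib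
  `ContinuousCohomology.map` along the identity of `U_P`) — in BOTH directions (`congr_symm_forall`).
NOT here: part 1b (`levelTwistO_levelTwistO` mutual inverses via `map_comp`/`map = 𝟙`, naturality with `levelRedO`/`levelScalarO` via `map_comp`) and part 2 (the honest L of «D-tw-coh»): naturality with the corestrictions `relCoresO` (cor for `U_P`-morphisms), the SEMILINEARITY `tw ∘ conj^θ_γ =
η(γ)·conj^{θ'}_γ ∘ tw` for `γ ∉ U`, and the cofinal assembly `D(χ₀).Dᵢ.H ≃+ D(θ*).Dᵢ.H` on the pinned data carrying pins/`Z`/`nsub`. THEOREMS + transparent `def`s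
(maps, no structure, no instance); no named fact, no `sorry`; crux L, crux M, E2 and BSD remain OPEN and are proved for NO curve by any of this.
References: [SerreGaloisCohomology1997] I §2.2 (functoriality of `H^q(G, A)` in `A`); [Rubin2000] Ch. VI §6.1–6.2 (twisting by characters of `Γ`); [JohnsonLeungKings2011]
§4.2 Def. 4.2 (arXiv 0804.2828 p0012:L80–112); [Kato2004Asterisque] §8.2 (p. 180).
-/

set_option autoImplicit false
-- the Theorems namespace of this sub repeats the summit name by design (D-0017 nested layout)
set_option linter.dupNamespace false

noncomputable section

open scoped NumberField TensorProduct
open CategoryTheory Field IsDedekindDomain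
open Literature.NumberTheory.GaloisRepresentations
open Literature.NumberTheory.GaloisRepresentations.DiscreteGaloisModule
open Literature.NumberTheory.EllipticCurves
open Literature.NumberTheory.ComplexMultiplication.EllipticUnits
open Literature.NumberTheory.ComplexMultiplication.EllipticUnits.JohnsonLeungKings2011

namespace Summit.BirchSwinnertonDyer.BirchSwinnertonDyer.Theorems.SmallImageRttD2Twist

variable {K : Type} [Field K] [NumberField K] {p : ℕ} [Fact p.Prime] (S : Set (PadicAlgCl p))
  (P : Set (HeightOneSpectrum (𝓞 K))) (θ θ' : absoluteGaloisGroup K →ₜ* (padicCoeffIntegers S)ˣ) (k : ℕ)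

/-! ## §1 Congruent characters act identically on `𝒪 ⊗ μ_{p^k}` -/

omit [NumberField K] in
/-- **If `θ' σ = θ σ + p^k·b` then `σ` acts identically on `𝒪 ⊗ μ_{p^k} ⊗ θ` and on `𝒪 ⊗ μ_{p^k} ⊗ θ'`** (`(θ'σ − θσ)a ⊗ σζ = b a ⊗ p^k σζ = 0`).
[cite: Rubin2000, Ch. VI §6.1 (twisting by characters)] [cite: JohnsonLeungKings2011, Def. 4.2 (arXiv p0012:L80–95)] -/
theorem muTwistO_eq_of_congr {σ : absoluteGaloisGroup K} {b : padicCoeffIntegers S}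
    (h : ((θ' σ : (padicCoeffIntegers S)ˣ) : padicCoeffIntegers S) = (θ σ : (padicCoeffIntegers S)ˣ) + ((p : padicCoeffIntegers S)) ^ k * b)
    (x : OMuCarrier K S (p ^ k)) : muTwistO S θ' k σ x = muTwistO S θ k σ x := by
  induction x using OMuCarrier.induction_on with
  | zero => rw [map_zero, map_zero]
  | tmul a v =>
    rw [muTwistO_tmul, muTwistO_tmul, h, add_mul, OMuCarrier.add_tmul, add_eq_left, mul_assoc,
      show (((p : padicCoeffIntegers S)) ^ k * (b * a)) = ((p : ℤ) ^ k) • (b * a) by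
        rw [zsmul_eq_mul, Int.cast_pow, Int.cast_natCast]]
    change OMuCarrier.toTensor.symm ((((p : ℤ) ^ k) • (b * a)) ⊗ₜ mu K (p ^ k) σ v) = 0
    rw [← TensorProduct.smul_tmul', map_zsmul]
    exact OMuCarrier.pow_smul_eq_zero S k _
  | add x y hx hy => rw [map_add, map_add, hx, hy]

omit [NumberField K] in
/-- The congruence is symmetric: `θ σ = θ' σ + p^k·(−b)`. [folklore] -/
theorem congr_symm {σ : absoluteGaloisGroup K} {b : padicCoeffIntegers S}
    (h : ((θ' σ : (padicCoeffIntegers S)ˣ) : padicCoeffIntegers S) = (θ σ : (padicCoeffIntegers S)ˣ) + ((p : padicCoeffIntegers S)) ^ k * b) :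
    ((θ σ : (padicCoeffIntegers S)ˣ) : padicCoeffIntegers S) = (θ' σ : (padicCoeffIntegers S)ˣ) + ((p : padicCoeffIntegers S)) ^ k * (-b) := by
  rw [h]; ring

/-! ## §2 The level twist -/

section Twist

variable (hN : ∀ σ ∈ ramificationSubgroup K P, ∃ b : padicCoeffIntegers S,
    ((θ' σ : (padicCoeffIntegers S)ˣ) : padicCoeffIntegers S) = (θ σ : (padicCoeffIntegers S)ˣ) + ((p : padicCoeffIntegers S)) ^ k * b)

/-- **The identity of `(𝒪 ⊗ μ_{p^k})^{N_P}` between the two twists**: an `N_P`-invariant vector for `θ` is `N_P`-invariant for `θ'` when `θ' ≡ θ (mod p^k)` on `N_P`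
(e.g. both unramified outside `P`). [cite: Rubin2000, Ch. VI §6.1] [cite: JohnsonLeungKings2011, §2.1 Def. 2.1 and Def. 4.2 (arXiv p0006:L36–41, p0012:L80–95)] -/
def twistCoeffMapO :
    Representation.invariants ((muTwistO S θ k).toRepresentation.comp (ramificationSubgroup K P).subtype) →ₗ[ℤ]
      Representation.invariants ((muTwistO S θ' k).toRepresentation.comp (ramificationSubgroup K P).subtype) where
  toFun w := ⟨(w : OMuCarrier K S (p ^ k)), by
    rw [Representation.mem_invariants]
    intro g
    have hg := (Representation.mem_invariants _ _).mp w.2 g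
    simp only [MonoidHom.coe_comp, Subgroup.coe_subtype, Function.comp_apply, ContinuousRep.toRepresentation_apply] at hg ⊢
    obtain ⟨b, hb⟩ := hN g g.2
    rw [muTwistO_eq_of_congr S θ θ' k hb, hg]⟩
  map_add' _ _ := Subtype.ext rfl
  map_smul' _ _ := Subtype.ext rfl

variable (U : Subgroup (absoluteGaloisGroup K))
  (hU : ∀ σ ∈ U, ∃ b : padicCoeffIntegers S,
    ((θ' σ : (padicCoeffIntegers S)ˣ) : padicCoeffIntegers S) = (θ σ : (padicCoeffIntegers S)ˣ) + ((p : padicCoeffIntegers S)) ^ k * b)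

omit [NumberField K] in
/-- Unfolding the level action on vectors: `(σ|_{U_P} · w) = θ(σ)·(id ⊗ σ) w` (the tree's `quotientInvariants_apply_coe`). [cite: JohnsonLeungKings2011, Def. 4.2 (arXiv p0012:L80–95)] -/
theorem coe_levelRepO_apply_mk (σ : absoluteGaloisGroup K) (hσ : toUnramifiedQuot K P σ ∈ imGS P U)
    (w : Representation.invariants ((muTwistO S θ k).toRepresentation.comp (ramificationSubgroup K P).subtype)) :
    (((levelRepO S P θ U k) ⟨toUnramifiedQuot K P σ, hσ⟩ w :
        Representation.invariants ((muTwistO S θ k).toRepresentation.comp (ramificationSubgroup K P).subtype)) : OMuCarrier K S (p ^ k)) =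
      muTwistO S θ k σ w :=
  DiscreteGaloisModule.quotientInvariants_apply_coe (muTwistO S θ k) (ramificationSubgroup K P) σ w

/-- **The level twist as a morphism of topological `U_P`-modules** `(𝒪 ⊗ μ_{p^k} ⊗ θ)^{N_P}|_{U_P} ⟶ (𝒪 ⊗ μ_{p^k} ⊗ θ')^{N_P}|_{U_P}`: the identity on vectors, equivariant
because `θ' ≡ θ (mod p^k)` on `U`. [cite: Rubin2000, Ch. VI §6.1] [cite: SerreGaloisCohomology1997, I §2.2] -/
def twistLevelHomO : (levelRepO S P θ U k).toTopRep ⟶ (levelRepO S P θ' U k).toTopRep :=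
  TopRep.ofHom ⟨⟨twistCoeffMapO S P θ θ' k hN, continuous_of_discreteTopology⟩, fun g ↦ by
    ext w
    obtain ⟨g, hg⟩ := g
    obtain ⟨σ, hσU, rfl⟩ := hg
    obtain ⟨b, hb⟩ := hU σ hσU
    show (((levelRepO S P θ U k) ⟨toUnramifiedQuot K P σ, Subgroup.mem_map_of_mem _ hσU⟩ w :
        Representation.invariants ((muTwistO S θ k).toRepresentation.comp (ramificationSubgroup K P).subtype)) : OMuCarrier K S (p ^ k)) =
      (((levelRepO S P θ' U k) ⟨toUnramifiedQuot K P σ, Subgroup.mem_map_of_mem _ hσU⟩ (twistCoeffMapO S P θ θ' k hN w) :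
        Representation.invariants ((muTwistO S θ' k).toRepresentation.comp (ramificationSubgroup K P).subtype)) : OMuCarrier K S (p ^ k))
    rw [coe_levelRepO_apply_mk, coe_levelRepO_apply_mk]
    exact (muTwistO_eq_of_congr S θ θ' k hb (w : OMuCarrier K S (p ^ k))).symm⟩

/-- ★ **The level twist `tw : H^i(G_P(F), 𝒪 ⊗ μ_{p^k} ⊗ θ) → H^i(G_P(F), 𝒪 ⊗ μ_{p^k} ⊗ θ')`** (`U = Gal(K̄/F)`): Mathlib's functoriality of continuous cohomology in the
coefficients along `twistLevelHomO` — the identity on cochains. [cite: SerreGaloisCohomology1997, I §2.2] [cite: Rubin2000, Ch. VI §6.1–6.2] -/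
def levelTwistO (i : ℕ) : levelCohO S P θ U k i →+ levelCohO S P θ' U k i :=
  (ContinuousCohomology.map (ContinuousMonoidHom.id _) (twistLevelHomO S P θ θ' k hN U hU) i).hom.toLinearMap.toAddMonoidHom

omit [NumberField K] in
/-- Unfolding `levelTwistO`. [cite: SerreGaloisCohomology1997, I §2.2] -/
theorem levelTwistO_apply (i : ℕ) (y : levelCohO S P θ U k i) :
    levelTwistO S P θ θ' k hN U hU i y = (ContinuousCohomology.map (ContinuousMonoidHom.id _) (twistLevelHomO S P θ θ' k hN U hU) i).hom y := rfl

omit [NumberField K] in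
/-- The hypotheses for the inverse twist `θ' ⇝ θ`. [folklore] -/
theorem congr_symm_forall {V : Subgroup (absoluteGaloisGroup K)}
    (hV : ∀ σ ∈ V, ∃ b : padicCoeffIntegers S,
      ((θ' σ : (padicCoeffIntegers S)ˣ) : padicCoeffIntegers S) = (θ σ : (padicCoeffIntegers S)ˣ) + ((p : padicCoeffIntegers S)) ^ k * b) :
    ∀ σ ∈ V, ∃ b : padicCoeffIntegers S,
      ((θ σ : (padicCoeffIntegers S)ˣ) : padicCoeffIntegers S) = (θ' σ : (padicCoeffIntegers S)ˣ) + ((p : padicCoeffIntegers S)) ^ k * b :=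
  fun σ hσ ↦ by obtain ⟨b, hb⟩ := hV σ hσ; exact ⟨-b, congr_symm S θ θ' k hb⟩

end Twist

end Summit.BirchSwinnertonDyer.BirchSwinnertonDyer.Theorems.SmallImageRttD2Twist

end
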